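import Literature.Barriers.AtomisticToContinuum.DisorderedHarmonicChainPotential
import Mathlib.Analysis.SpecialFunctions.Integrals.Basic
import Mathlib.Analysis.SpecialFunctions.Trigonometric.Bounds
import Mathlib.Analysis.Calculus.Deriv.Pow
import Mathlib.Analysis.Calculus.IteratedDeriv.Defs
import Mathlib.Algebra.Order.Ring.Pow
import HarnessLib

/-!
# Ajanki–Huveneers 2011, Lemma 5.3: the printed estimate (5.12) on `R_y` is false — a formal counterexample

Seventh file of the Casher–Lebowitz / Ajanki–Huveneers cluster (O. Ajanki, F. Huveneers, CMP **301**
(2011) 841–883, arXiv:1003.1076). The named fact `AjankiHuveneers2011_RyEstimate`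
(`DisorderedHarmonicChainPotential.lean`; since the verdict clean-up of 2026-08-16 a `@[deprecated]`
record kept verbatim only because this refutation names it — hence the two
`set_option linter.deprecated false in` below) transcribes Lemma 5.3, eq. (5.12), faithfully:

  "`‖R_y u‖_∞ ≤ K w² {‖sin π(·-y-w) · u'‖_∞ + w‖u'‖_∞ + ‖sin² π(·-y-w) · u''‖_∞ + w‖u''‖_∞}`
  for every `u ∈ C²(𝕋)` and every `y ∈ 𝕋`" (constants depending on `h`, `τ` only).

This file PROVES ITS NEGATION (`AjankiHuveneers2011_RyEstimate_false`). The printed proof errs at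
(5.13): the mean-value point `x + w + ξ₁` lies between `g_b(x,y) = x + ϑ + Φ(y,b)` and
`f_b(x) = x + ϑ + Φ(x,b)`, so `ξ₁ = 𝒪(w)` and not `𝒪(w|φ(x) - φ(y)| + w²)`; the resulting cross term
`w² |sin π(x-y)| |u''|` carries one power of the sine only. The corrected lemma (with
`‖sin π(·-y-w) u''‖_∞`) is vendored and proved in `DisorderedHarmonicChainRyEstimate.lean`.

## The counterexample

Reduced law `τ` = uniform density on `[-1/2, 1/2]` (`𝔼B = 0`, `𝔼B² = 1/12`), `h = 0`, and for a
(large) integer `m`: `t = 1/m`, `w = m⁻³`, `y = 1/4`, `x = 1/4 + t`, `c = x + ϑ(w)`,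
`u(z) = cos^{4m²+2}(π(z - c))` (a `1`-periodic trigonometric polynomial, a bump of width `∼ 1/m = t`
at `c`). Then `u∘f_b(x) = cos^{4m²+2}(πΦ(x,b))`, `u∘g_b(x,y) = cos^{4m²+2}(πΦ(y,b))`, and with
`N' = 2m² + 1`, `σ = sin²`:
* `(1-σ)^{N'} ≥ 1 - N'σ` and `(1-σ)^{N'} ≤ 1 - N'σ + N'²σ²` give
  `-R_y u(x) = ∫ [cos^{2N'}(πΦ(y,b)) - cos^{2N'}(πΦ(x,b))] db ≥ N' ∫ [σ(πΦ(x,b)) - σ(πΦ(y,b))] db - N'²𝒪(w⁴)`;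
* the expansion (3.11) of `Φ` gives `Φ(x,b)² - Φ(y,b)² ≥ w²b²t/2` (from
  `sin²(πx) - sin²(πy) = sin(2πt)/2 ≥ 2t`), whence `σ(πΦ(x,b)) - σ(πΦ(y,b)) ≥ π²w²b²t/2 - 𝒪(w⁴)` and
  `-R_y u(x) ≥ N'π²w²t/24 - 𝒪(m⁴w⁴) ≥ w²(π²m/12 - C)`;
* while, by the Bernoulli-type bounds `(1-σ)ʲσ ≤ 1/j`, the four majorants can be taken
  `A₁ = 3π + 6π²`, `A₁' = 3πm`, `A₂ = 78π² + 192π⁴`, `A₂' = 24π²m²`, so that the right-hand side of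
  (5.12) is `≤ 51000 K w²`.
For `m` large (`m ≳ K + C`) the two are incompatible.

## Sources

O. Ajanki, F. Huveneers, CMP 301 (2011) 841–883, arXiv:1003.1076: Lemma 5.3 eqs. (5.12)–(5.13);
Lemma 3.2 eq. (3.11); Lemma 3.1 eq. (3.4).
-/

noncomputable section

open MeasureTheory Real Set

namespace Literature.Barriers.AtomisticToContinuum.HeatConduction

namespace RyCounterexample

/-! ### The uniform reduced law on `[-1/2, 1/2]` -/

/-- The uniform density on `[-1/2, 1/2]`. [folklore] -/
def τu : ℝ → ℝ := Set.indicator (Set.Icc (-(1 / 2 : ℝ)) (1 / 2)) fun _ => 1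

/-- `∫ f τᵤ = ∫_{-1/2}^{1/2} f`. [folklore] -/
theorem integral_mul_τu (f : ℝ → ℝ) :
    ∫ b, f b * τu b = ∫ b in (-(1 / 2 : ℝ))..(1 / 2), f b := by
  have e : (fun b => f b * τu b) = Set.indicator (Set.Icc (-(1 / 2 : ℝ)) (1 / 2)) f := by
    funext b
    unfold τu
    rw [← Set.indicator_mul_right _ f (fun _ => (1 : ℝ))]
    simp
  rw [e, integral_indicator measurableSet_Icc, integral_Icc_eq_integral_Ioc,
    intervalIntegral.integral_of_le (by norm_num)]

/-- `∫ τᵤ = 1`. [folklore] -/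
theorem integral_τu : ∫ b, τu b = 1 := by
  have h := integral_mul_τu fun _ => 1
  simp only [one_mul] at h
  rw [h, intervalIntegral.integral_const]
  norm_num

/-- `∫ b τᵤ(b) db = 0`. [folklore] -/
theorem integral_id_mul_τu : ∫ b, b * τu b = 0 := by
  rw [integral_mul_τu fun b => b, integral_id]
  norm_num

/-- `∫ b² τᵤ(b) db = 1/12`. [folklore] -/
theorem integral_sq_mul_τu : ∫ b, b ^ 2 * τu b = 1 / 12 := by
  rw [integral_mul_τu fun b => b ^ 2, integral_pow]
  norm_num

/-- `τᵤ` is `1` on `[-1/2, 1/2]`. [folklore] -/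
theorem τu_of_mem {b : ℝ} (hb : b ∈ Set.Icc (-(1 / 2 : ℝ)) (1 / 2)) : τu b = 1 := by
  unfold τu; rw [Set.indicator_of_mem hb]

/-- `τᵤ` vanishes off `[-1/2, 1/2]`. [folklore] -/
theorem τu_of_not_mem {b : ℝ} (hb : b ∉ Set.Icc (-(1 / 2 : ℝ)) (1 / 2)) : τu b = 0 := by
  unfold τu; rw [Set.indicator_of_notMem hb]

/-- The uniform law on `[-1/2, 1/2]` satisfies the standing hypotheses of AH2011 §2 on the reduced
masses. [cite: AjankiHuveneers2011, §2 ¶1] -/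
theorem reducedLawHyp_τu : ReducedLawHyp τu (-(1 / 2)) (1 / 2) where
  lo := by norm_num
  lt := by norm_num
  nonneg s := by
    unfold τu
    exact Set.indicator_nonneg (fun _ _ => zero_le_one) s
  eq_zero s hs := τu_of_not_mem hs
  continuousOn := continuousOn_const.congr fun s hs => τu_of_mem hs
  contDiffOn := contDiffOn_const.congr fun s hs => τu_of_mem (Set.Ioo_subset_Icc_self hs)
  deriv_bound := by
    refine ⟨0, fun s hs => ?_⟩
    have hev : τu =ᶠ[nhds s] fun _ => (1 : ℝ) := by
      filter_upwards [isOpen_Ioo.mem_nhds hs] with b hb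
      exact τu_of_mem (Set.Ioo_subset_Icc_self hb)
    rw [hev.deriv_eq, deriv_const, abs_zero]
  integral_eq_one := integral_τu
  mean_zero := integral_id_mul_τu

/-! ### Bernoulli-type inequalities -/

/-- `(1-σ)ʲ σ ≤ 1/j` on `[0,1]` (from `(1 + jσ)(1-σ)ʲ ≤ (1-σ²)ʲ ≤ 1`). [folklore] -/
theorem one_sub_pow_mul_le {σ : ℝ} (h0 : 0 ≤ σ) (h1 : σ ≤ 1) {j : ℕ} (hj : 1 ≤ j) :
    (1 - σ) ^ j * σ ≤ 1 / j := by
  have hj0 : (0 : ℝ) < j := by exact_mod_cast hj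
  have hb1 : 1 + (j : ℝ) * σ ≤ (1 + σ) ^ j := one_add_mul_le_pow (by linarith) j
  have hp0 : 0 ≤ (1 - σ) ^ j := pow_nonneg (by linarith) j
  have h2 : (1 + (j : ℝ) * σ) * (1 - σ) ^ j ≤ 1 := by
    calc (1 + (j : ℝ) * σ) * (1 - σ) ^ j ≤ (1 + σ) ^ j * (1 - σ) ^ j :=
          mul_le_mul_of_nonneg_right hb1 hp0
      _ = (1 - σ ^ 2) ^ j := by rw [← mul_pow]; ring
      _ ≤ 1 ^ j := pow_le_pow_left₀ (by nlinarith) (by nlinarith) j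
      _ = 1 := one_pow j
  rw [le_div_iff₀ hj0]
  nlinarith

/-- Upper Bernoulli bound: `(1-σ)ⁿ ≤ 1 - nσ + n²σ²` on `[0,1]`. [folklore] -/
theorem one_sub_pow_le {σ : ℝ} (h0 : 0 ≤ σ) (h1 : σ ≤ 1) :
    ∀ n : ℕ, (1 - σ) ^ n ≤ 1 - n * σ + (n : ℝ) ^ 2 * σ ^ 2
  | 0 => by simp
  | n + 1 => by
    have ih := one_sub_pow_le h0 h1 n
    have hs : 0 ≤ 1 - σ := by linarith
    calc (1 - σ) ^ (n + 1) = (1 - σ) ^ n * (1 - σ) := pow_succ _ _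
      _ ≤ (1 - n * σ + (n : ℝ) ^ 2 * σ ^ 2) * (1 - σ) := mul_le_mul_of_nonneg_right ih hs
      _ ≤ 1 - (n + 1 : ℕ) * σ + ((n + 1 : ℕ) : ℝ) ^ 2 * σ ^ 2 := by
          push_cast
          nlinarith [mul_nonneg (mul_nonneg (sq_nonneg (n : ℝ)) (sq_nonneg σ)) h0,
            mul_nonneg (Nat.cast_nonneg n) (sq_nonneg σ), sq_nonneg σ]

/-- Lower Bernoulli bound: `1 - nσ ≤ (1-σ)ⁿ` for `σ ≤ 2`. [folklore] -/
theorem one_sub_mul_le_one_sub_pow {σ : ℝ} (h1 : σ ≤ 2) (n : ℕ) :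
    1 - n * σ ≤ (1 - σ) ^ n := by
  have := one_add_mul_le_pow (a := -σ) (by linarith) n
  simpa [sub_eq_add_neg] using this

/-- `p² - 2p⁴ ≤ sin² p` for `|p| ≤ 1` (from `|sin p - p| ≤ |p|³`). [folklore] -/
theorem sq_sub_le_sin_sq {p : ℝ} (hp : |p| ≤ 1) : p ^ 2 - 2 * p ^ 4 ≤ Real.sin p ^ 2 := by
  -- reduce to `q = |p| ∈ [0,1]`
  have key : ∀ q : ℝ, 0 ≤ q → q ≤ 1 → q ^ 2 - 2 * q ^ 4 ≤ Real.sin q ^ 2 := by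
    intro q hq0 hq1
    have hb := abs_sin_sub_self_le (t := q) (by rwa [abs_of_nonneg hq0])
    rw [abs_of_nonneg hq0] at hb
    have hlo : q - q ^ 3 ≤ Real.sin q := by linarith [(abs_le.mp hb).1]
    by_cases hq : q ^ 2 ≤ 1 / 2
    · have hnn : 0 ≤ q - q ^ 3 := by nlinarith
      have hsin0 : 0 ≤ Real.sin q :=
        Real.sin_nonneg_of_nonneg_of_le_pi hq0 (by linarith [Real.pi_gt_three])
      have h2 : (q - q ^ 3) ^ 2 ≤ Real.sin q ^ 2 := pow_le_pow_left₀ hnn hlo 2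
      nlinarith [sq_nonneg q, pow_nonneg hq0 6]
    · push Not at hq
      nlinarith [sq_nonneg (Real.sin q), sq_nonneg q]
  rcases le_or_gt 0 p with h | h
  · exact key p h (by rwa [abs_of_nonneg h] at hp)
  · have := key (-p) (by linarith) (by rwa [abs_of_neg h] at hp)
    have e4 : (-p) ^ 4 = p ^ 4 := by ring
    have e2 : (-p) ^ 2 = p ^ 2 := by ring
    rw [Real.sin_neg, e4, e2, neg_sq] at this
    exact this


/-! ### Powers of cosine: the Bernoulli bounds in trigonometric form -/

section CosPow

variable {m : ℕ} (hm : 1 ≤ m) (θ : ℝ)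
include hm

/-- `(cos²θ)^{2m²} sin²θ ≤ 1/(2m²)`. [folklore] -/
theorem cos_pow_mul_sin_sq_le :
    (Real.cos θ ^ 2) ^ (2 * m ^ 2) * Real.sin θ ^ 2 ≤ 1 / (2 * (m : ℝ) ^ 2) := by
  have hσ0 : 0 ≤ Real.sin θ ^ 2 := sq_nonneg _
  have hσ1 : Real.sin θ ^ 2 ≤ 1 := Real.sin_sq_le_one θ
  have h := one_sub_pow_mul_le hσ0 hσ1 (j := 2 * m ^ 2) (by nlinarith)
  rw [Real.cos_sq']
  convert h using 2
  push_cast; ring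

/-- `(cos²θ)^{2m²} |sin θ| ≤ 1/(2m)`. [folklore] -/
theorem cos_pow_mul_abs_sin_le :
    (Real.cos θ ^ 2) ^ (2 * m ^ 2) * |Real.sin θ| ≤ 1 / (2 * (m : ℝ)) := by
  have hσ0 : 0 ≤ Real.sin θ ^ 2 := sq_nonneg _
  have hσ1 : Real.sin θ ^ 2 ≤ 1 := Real.sin_sq_le_one θ
  have hm0 : (0 : ℝ) < m := by exact_mod_cast hm
  have h := one_sub_pow_mul_le hσ0 hσ1 (j := 4 * m ^ 2) (by nlinarith)
  have hsq : ((Real.cos θ ^ 2) ^ (2 * m ^ 2) * |Real.sin θ|) ^ 2 ≤ (1 / (2 * (m : ℝ))) ^ 2 := by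
    have e : ((Real.cos θ ^ 2) ^ (2 * m ^ 2) * |Real.sin θ|) ^ 2 =
        (1 - Real.sin θ ^ 2) ^ (4 * m ^ 2) * Real.sin θ ^ 2 := by
      rw [mul_pow, sq_abs, ← pow_mul, Real.cos_sq']
      congr 2
      ring
    rw [e]
    refine h.trans (le_of_eq ?_)
    push_cast
    field_simp
    ring
  exact (le_abs_self _).trans (abs_le_of_sq_le_sq hsq (by positivity))

/-- `(cos²θ)^{2m²} sin⁴θ ≤ 1/m⁴`. [folklore] -/
theorem cos_pow_mul_sin_four_le :
    (Real.cos θ ^ 2) ^ (2 * m ^ 2) * Real.sin θ ^ 4 ≤ 1 / (m : ℝ) ^ 4 := by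
  have hσ0 : 0 ≤ Real.sin θ ^ 2 := sq_nonneg _
  have hσ1 : Real.sin θ ^ 2 ≤ 1 := Real.sin_sq_le_one θ
  have hm0 : (0 : ℝ) < m := by exact_mod_cast hm
  have h := one_sub_pow_mul_le hσ0 hσ1 (j := m ^ 2) (by nlinarith)
  have h0 : 0 ≤ (1 - Real.sin θ ^ 2) ^ (m ^ 2) * Real.sin θ ^ 2 :=
    mul_nonneg (pow_nonneg (by linarith) _) hσ0
  have e : (Real.cos θ ^ 2) ^ (2 * m ^ 2) * Real.sin θ ^ 4 =
      ((1 - Real.sin θ ^ 2) ^ (m ^ 2) * Real.sin θ ^ 2) ^ 2 := by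
    rw [Real.cos_sq', mul_pow, ← pow_mul, mul_comm (m ^ 2) 2]
    ring
  rw [e]
  calc ((1 - Real.sin θ ^ 2) ^ (m ^ 2) * Real.sin θ ^ 2) ^ 2 ≤ (1 / (m ^ 2 : ℕ)) ^ 2 :=
        pow_le_pow_left₀ h0 h 2
    _ = 1 / (m : ℝ) ^ 4 := by push_cast; field_simp

end CosPow

/-! ### The test function `u = cos^{k+2}(π(· - c))` and its derivatives -/

/-- `u_k(z) = cos^{k+2}(π(z - c))`. [folklore] -/
def uK (k : ℕ) (c z : ℝ) : ℝ := Real.cos (π * (z - c)) ^ (k + 2)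

/-- `u_k'`. [folklore] -/
def uK1 (k : ℕ) (c z : ℝ) : ℝ :=
  -((k : ℝ) + 2) * π * Real.cos (π * (z - c)) ^ (k + 1) * Real.sin (π * (z - c))

/-- `u_k''`. [folklore] -/
def uK2 (k : ℕ) (c z : ℝ) : ℝ :=
  ((k : ℝ) + 2) * ((k : ℝ) + 1) * π ^ 2 * Real.cos (π * (z - c)) ^ k * Real.sin (π * (z - c)) ^ 2 -
    ((k : ℝ) + 2) * π ^ 2 * Real.cos (π * (z - c)) ^ (k + 2)

section TestFunction

variable (k : ℕ) (c : ℝ)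

/-- `d/dz [π(z - c)] = π`. [folklore] -/
theorem hasDerivAt_arg (z : ℝ) : HasDerivAt (fun z : ℝ => π * (z - c)) π z := by
  simpa using ((hasDerivAt_id z).sub_const c).const_mul π

/-- `u_k' = uK1`. [folklore] -/
theorem hasDerivAt_uK (z : ℝ) : HasDerivAt (uK k c) (uK1 k c z) z := by
  have hcos : HasDerivAt (fun z : ℝ => Real.cos (π * (z - c)))
      (-Real.sin (π * (z - c)) * π) z := (Real.hasDerivAt_cos _).comp z (hasDerivAt_arg c z)
  have h := hcos.fun_pow (k + 2)
  have e : k + 2 - 1 = k + 1 := by omega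
  rw [e] at h
  show HasDerivAt (fun z : ℝ => Real.cos (π * (z - c)) ^ (k + 2)) (uK1 k c z) z
  refine h.congr_deriv ?_
  unfold uK1; push_cast; ring

/-- `u_k'' = uK2`. [folklore] -/
theorem hasDerivAt_uK1 (z : ℝ) : HasDerivAt (uK1 k c) (uK2 k c z) z := by
  have hcos : HasDerivAt (fun z : ℝ => Real.cos (π * (z - c)))
      (-Real.sin (π * (z - c)) * π) z := (Real.hasDerivAt_cos _).comp z (hasDerivAt_arg c z)
  have hsin : HasDerivAt (fun z : ℝ => Real.sin (π * (z - c)))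
      (Real.cos (π * (z - c)) * π) z := (Real.hasDerivAt_sin _).comp z (hasDerivAt_arg c z)
  have hpow := hcos.fun_pow (k + 1)
  have e : k + 1 - 1 = k := by omega
  rw [e] at hpow
  have h := (hpow.const_mul (-((k : ℝ) + 2) * π)).fun_mul hsin
  show HasDerivAt (fun z : ℝ => -((k : ℝ) + 2) * π * Real.cos (π * (z - c)) ^ (k + 1) *
    Real.sin (π * (z - c))) (uK2 k c z) z
  refine h.congr_deriv ?_
  unfold uK2; push_cast; ring

/-- `u_k' = uK1` (as `deriv`). [folklore] -/
theorem deriv_uK : deriv (uK k c) = uK1 k c := funext fun z => (hasDerivAt_uK k c z).deriv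

/-- `uK1' = uK2` (as `deriv`). [folklore] -/
theorem deriv_uK1 : deriv (uK1 k c) = uK2 k c := funext fun z => (hasDerivAt_uK1 k c z).deriv

/-- `u_k'' = uK2` as an iterated derivative. [folklore] -/
theorem iteratedDeriv_two_uK : iteratedDeriv 2 (uK k c) = uK2 k c := by
  rw [show (2 : ℕ) = 1 + 1 from rfl, iteratedDeriv_succ, iteratedDeriv_one, deriv_uK, deriv_uK1]

/-- `u_k ∈ C²`. [folklore] -/
theorem contDiff_uK : ContDiff ℝ 2 (uK k c) := by
  have h1 : Differentiable ℝ (uK k c) := fun z => (hasDerivAt_uK k c z).differentiableAt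
  have h2 : Differentiable ℝ (uK1 k c) := fun z => (hasDerivAt_uK1 k c z).differentiableAt
  have h3 : Continuous (uK2 k c) := by unfold uK2; fun_prop
  rw [show (2 : WithTop ℕ∞) = 1 + 1 from rfl, contDiff_succ_iff_deriv, deriv_uK]
  refine ⟨h1, by simp, ?_⟩
  rw [show (1 : WithTop ℕ∞) = 0 + 1 from rfl, contDiff_succ_iff_deriv, deriv_uK1]
  exact ⟨h2, by simp, contDiff_zero.mpr h3⟩

/-- `u_k` is `1`-periodic for even `k`. [folklore] -/
theorem periodic_uK (hk : Even k) : Function.Periodic (uK k c) 1 := by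
  intro z
  unfold uK
  have e : π * (z + 1 - c) = π * (z - c) + π := by ring
  rw [e, Real.cos_add_pi, Even.neg_pow (hk.add (by decide))]

end TestFunction

/-- The shifted sine: `|sin(θ + πδ)| ≤ |sin θ| + π|δ|`. [folklore] -/
theorem abs_sin_add_le (θ δ : ℝ) : |Real.sin (θ + π * δ)| ≤ |Real.sin θ| + π * |δ| := by
  have h := Real.abs_sin_sub_sin_le (θ + π * δ) θ
  rw [add_sub_cancel_left, abs_mul, abs_of_pos Real.pi_pos] at h
  have := abs_sub_abs_le_abs_sub (Real.sin (θ + π * δ)) (Real.sin θ)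
  linarith

/-- `|A X S - B Y| ≤ A (X S) + B |Y|` for non-negative `A, X, S, B`. [folklore] -/
theorem abs_sub_le_of_nonneg {A X S B : ℝ} (Y : ℝ) (hA : 0 ≤ A) (hX : 0 ≤ X) (hS : 0 ≤ S)
    (hB : 0 ≤ B) : |A * X * S - B * Y| ≤ A * (X * S) + B * |Y| := by
  calc |A * X * S - B * Y| ≤ |A * X * S| + |B * Y| := abs_sub _ _
    _ = A * (X * S) + B * |Y| := by
        rw [abs_mul B Y, abs_of_nonneg hB, abs_of_nonneg (by positivity : 0 ≤ A * X * S)]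
        ring

/-! ### The four majorants for `u = cos^{4m²+2}(π(· - c))` -/

section Majorants

variable {m : ℕ} (hm : 1 ≤ m) (c : ℝ)
include hm

/-- `|u'| ≤ 3πm`. [folklore] -/
theorem abs_uK1_le (z : ℝ) : |uK1 (2 * (2 * m ^ 2)) c z| ≤ 3 * π * m := by
  have hm0 : (1 : ℝ) ≤ m := by exact_mod_cast hm
  set θ := π * (z - c) with hθ
  have hC : |Real.cos θ| ≤ 1 := Real.abs_cos_le_one θ
  have hpow : |Real.cos θ| ^ (2 * (2 * m ^ 2) + 1) ≤ |Real.cos θ| ^ (2 * (2 * m ^ 2)) :=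
    pow_le_pow_of_le_one (abs_nonneg _) hC (by omega)
  have hkey := cos_pow_mul_abs_sin_le hm θ
  have habs : |Real.cos θ| ^ (2 * (2 * m ^ 2)) = (Real.cos θ ^ 2) ^ (2 * m ^ 2) := by
    rw [pow_mul, sq_abs]
  unfold uK1
  rw [← hθ, abs_mul, abs_mul, abs_mul, abs_neg, abs_of_pos Real.pi_pos, abs_pow,
    abs_of_pos (by positivity : (0:ℝ) < ((2 * (2 * m ^ 2) : ℕ) : ℝ) + 2)]
  push_cast
  calc (2 * (2 * (m : ℝ) ^ 2) + 2) * π * |Real.cos θ| ^ (2 * (2 * m ^ 2) + 1) * |Real.sin θ|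
      ≤ (6 * (m : ℝ) ^ 2) * π * (|Real.cos θ| ^ (2 * (2 * m ^ 2)) * |Real.sin θ|) := by
        rw [mul_assoc ((6 : ℝ) * _ ) π, mul_assoc, mul_assoc]
        gcongr (?_ * (π * ?_))
        · nlinarith
        · exact mul_le_mul_of_nonneg_right hpow (abs_nonneg _)
    _ ≤ (6 * (m : ℝ) ^ 2) * π * (1 / (2 * (m : ℝ))) := by rw [habs]; gcongr
    _ = 3 * π * m := by field_simp; ring


/-- `|sin π(·-y-w) · u'| ≤ 3π + 6π²` when `|c - y - w| ≤ 2/m`. [folklore] -/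
theorem abs_sin_mul_uK1_le {y w : ℝ} (hδ : |c - y - w| ≤ 2 / m) (z : ℝ) :
    |Real.sin (π * (z - y - w)) * uK1 (2 * (2 * m ^ 2)) c z| ≤ 3 * π + 6 * π ^ 2 := by
  have hm0 : (1 : ℝ) ≤ m := by exact_mod_cast hm
  have hmpos : (0 : ℝ) < m := by linarith
  set θ := π * (z - c) with hθ
  have hC : |Real.cos θ| ≤ 1 := Real.abs_cos_le_one θ
  have hpow : |Real.cos θ| ^ (2 * (2 * m ^ 2) + 1) ≤ |Real.cos θ| ^ (2 * (2 * m ^ 2)) :=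
    pow_le_pow_of_le_one (abs_nonneg _) hC (by omega)
  have habs : |Real.cos θ| ^ (2 * (2 * m ^ 2)) = (Real.cos θ ^ 2) ^ (2 * m ^ 2) := by
    rw [pow_mul, sq_abs]
  have k1 := cos_pow_mul_abs_sin_le hm θ
  have k2 := cos_pow_mul_sin_sq_le hm θ
  have hshift : |Real.sin (π * (z - y - w))| ≤ |Real.sin θ| + π * (2 / m) := by
    have e : π * (z - y - w) = θ + π * (c - y - w) := by rw [hθ]; ring
    rw [e]
    exact (abs_sin_add_le θ _).trans (by gcongr)
  have hE : (2 * (2 * (m : ℝ) ^ 2) + 2) ≤ 6 * (m : ℝ) ^ 2 := by nlinarith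
  -- |u'| factorised
  have hu1 : |uK1 (2 * (2 * m ^ 2)) c z| ≤
      (6 * (m : ℝ) ^ 2) * π * ((Real.cos θ ^ 2) ^ (2 * m ^ 2) * |Real.sin θ|) := by
    unfold uK1
    rw [← hθ, abs_mul, abs_mul, abs_mul, abs_neg, abs_of_pos Real.pi_pos, abs_pow,
      abs_of_pos (by positivity : (0:ℝ) < ((2 * (2 * m ^ 2) : ℕ) : ℝ) + 2)]
    push_cast
    rw [← habs]
    have h1 : |Real.cos θ| ^ (2 * (2 * m ^ 2) + 1) * |Real.sin θ| ≤
        |Real.cos θ| ^ (2 * (2 * m ^ 2)) * |Real.sin θ| :=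
      mul_le_mul_of_nonneg_right hpow (abs_nonneg _)
    have h2 : 0 ≤ |Real.cos θ| ^ (2 * (2 * m ^ 2) + 1) * |Real.sin θ| := by positivity
    calc (2 * (2 * (m : ℝ) ^ 2) + 2) * π * |Real.cos θ| ^ (2 * (2 * m ^ 2) + 1) * |Real.sin θ|
        = (2 * (2 * (m : ℝ) ^ 2) + 2) * π * (|Real.cos θ| ^ (2 * (2 * m ^ 2) + 1) * |Real.sin θ|) := by
          ring
      _ ≤ (6 * (m : ℝ) ^ 2) * π * (|Real.cos θ| ^ (2 * (2 * m ^ 2)) * |Real.sin θ|) := by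
          gcongr
  rw [abs_mul]
  calc |Real.sin (π * (z - y - w))| * |uK1 (2 * (2 * m ^ 2)) c z|
      ≤ (|Real.sin θ| + π * (2 / m)) *
          ((6 * (m : ℝ) ^ 2) * π * ((Real.cos θ ^ 2) ^ (2 * m ^ 2) * |Real.sin θ|)) := by gcongr
    _ = (6 * (m : ℝ) ^ 2) * π * ((Real.cos θ ^ 2) ^ (2 * m ^ 2) * (|Real.sin θ| * |Real.sin θ|)) +
          (6 * (m : ℝ) ^ 2) * π * (π * (2 / m)) *
            ((Real.cos θ ^ 2) ^ (2 * m ^ 2) * |Real.sin θ|) := by ring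
    _ ≤ (6 * (m : ℝ) ^ 2) * π * (1 / (2 * (m : ℝ) ^ 2)) +
          (6 * (m : ℝ) ^ 2) * π * (π * (2 / m)) * (1 / (2 * (m : ℝ))) := by
        rw [show |Real.sin θ| * |Real.sin θ| = Real.sin θ ^ 2 by rw [← sq, sq_abs]]
        gcongr
    _ = 3 * π + 6 * π ^ 2 := by field_simp; ring

/-- `|u''| ≤ 24π²m²`. [folklore] -/
theorem abs_uK2_le (z : ℝ) : |uK2 (2 * (2 * m ^ 2)) c z| ≤ 24 * π ^ 2 * m ^ 2 := by
  have hm0 : (1 : ℝ) ≤ m := by exact_mod_cast hm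
  set θ := π * (z - c) with hθ
  have hC : |Real.cos θ| ≤ 1 := Real.abs_cos_le_one θ
  have hcosk : Real.cos θ ^ (2 * (2 * m ^ 2)) = (Real.cos θ ^ 2) ^ (2 * m ^ 2) := by
    rw [pow_mul]
  have k2 := cos_pow_mul_sin_sq_le hm θ
  have hEE : (2 * (2 * (m : ℝ) ^ 2) + 2) * (2 * (2 * (m : ℝ) ^ 2) + 1) ≤ 36 * (m : ℝ) ^ 4 := by
    nlinarith [pow_le_pow_left₀ zero_le_one hm0 2, pow_le_pow_left₀ zero_le_one hm0 4]
  have hE : (2 * (2 * (m : ℝ) ^ 2) + 2) ≤ 6 * (m : ℝ) ^ 2 := by nlinarith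
  have hY : |Real.cos θ ^ (2 * (2 * m ^ 2) + 2)| ≤ 1 := by
    rw [abs_pow]; exact pow_le_one₀ (abs_nonneg _) hC
  unfold uK2
  rw [← hθ]
  push_cast
  rw [hcosk]
  refine (abs_sub_le_of_nonneg _ (by positivity) (by positivity) (sq_nonneg _)
    (by positivity)).trans ?_
  calc (2 * (2 * (m : ℝ) ^ 2) + 2) * (2 * (2 * (m : ℝ) ^ 2) + 1) * π ^ 2 *
        ((Real.cos θ ^ 2) ^ (2 * m ^ 2) * Real.sin θ ^ 2) +
        (2 * (2 * (m : ℝ) ^ 2) + 2) * π ^ 2 * |Real.cos θ ^ (2 * (2 * m ^ 2) + 2)|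
      ≤ 36 * (m : ℝ) ^ 4 * π ^ 2 * (1 / (2 * (m : ℝ) ^ 2)) + 6 * (m : ℝ) ^ 2 * π ^ 2 * 1 := by
        gcongr ?_ * _ * ?_ + ?_ * _ * ?_
    _ = 24 * π ^ 2 * m ^ 2 := by field_simp; ring

/-- `|sin² π(·-y-w) · u''| ≤ 78π² + 192π⁴` when `|c - y - w| ≤ 2/m`. [folklore] -/
theorem abs_sin_sq_mul_uK2_le {y w : ℝ} (hδ : |c - y - w| ≤ 2 / m) (z : ℝ) :
    |Real.sin (π * (z - y - w)) ^ 2 * uK2 (2 * (2 * m ^ 2)) c z| ≤ 78 * π ^ 2 + 192 * π ^ 4 := by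
  have hm0 : (1 : ℝ) ≤ m := by exact_mod_cast hm
  have hmpos : (0 : ℝ) < m := by linarith
  set θ := π * (z - c) with hθ
  have hC : |Real.cos θ| ≤ 1 := Real.abs_cos_le_one θ
  have hcosk : Real.cos θ ^ (2 * (2 * m ^ 2)) = (Real.cos θ ^ 2) ^ (2 * m ^ 2) := by
    rw [pow_mul]
  have k2 := cos_pow_mul_sin_sq_le hm θ
  have k4 := cos_pow_mul_sin_four_le hm θ
  have hu2 := abs_uK2_le hm c z
  have hEE : (2 * (2 * (m : ℝ) ^ 2) + 2) * (2 * (2 * (m : ℝ) ^ 2) + 1) ≤ 36 * (m : ℝ) ^ 4 := by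
    nlinarith [pow_le_pow_left₀ zero_le_one hm0 2, pow_le_pow_left₀ zero_le_one hm0 4]
  have hE : (2 * (2 * (m : ℝ) ^ 2) + 2) ≤ 6 * (m : ℝ) ^ 2 := by nlinarith
  have hshift : |Real.sin (π * (z - y - w))| ≤ |Real.sin θ| + π * (2 / m) := by
    have e : π * (z - y - w) = θ + π * (c - y - w) := by rw [hθ]; ring
    rw [e]
    exact (abs_sin_add_le θ _).trans (by gcongr)
  -- `|cos|^{k+2} ≤ (cos²)^{2m²}`
  have hY : |Real.cos θ ^ (2 * (2 * m ^ 2) + 2)| ≤ (Real.cos θ ^ 2) ^ (2 * m ^ 2) := by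
    rw [abs_pow, ← sq_abs (Real.cos θ), ← pow_mul]
    exact pow_le_pow_of_le_one (abs_nonneg _) hC (by omega)
  -- `sin²θ |u''| ≤ 39π²`
  have hcore : Real.sin θ ^ 2 * |uK2 (2 * (2 * m ^ 2)) c z| ≤ 39 * π ^ 2 := by
    have hs0 : 0 ≤ Real.sin θ ^ 2 := sq_nonneg _
    have h1 : |uK2 (2 * (2 * m ^ 2)) c z| ≤
        (2 * (2 * (m : ℝ) ^ 2) + 2) * (2 * (2 * (m : ℝ) ^ 2) + 1) * π ^ 2 *
          ((Real.cos θ ^ 2) ^ (2 * m ^ 2) * Real.sin θ ^ 2) +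
        (2 * (2 * (m : ℝ) ^ 2) + 2) * π ^ 2 * |Real.cos θ ^ (2 * (2 * m ^ 2) + 2)| := by
      unfold uK2
      rw [← hθ]
      push_cast
      rw [hcosk]
      exact abs_sub_le_of_nonneg _ (by positivity) (by positivity) (sq_nonneg _) (by positivity)
    calc Real.sin θ ^ 2 * |uK2 (2 * (2 * m ^ 2)) c z|
        ≤ Real.sin θ ^ 2 * ((2 * (2 * (m : ℝ) ^ 2) + 2) * (2 * (2 * (m : ℝ) ^ 2) + 1) * π ^ 2 *
          ((Real.cos θ ^ 2) ^ (2 * m ^ 2) * Real.sin θ ^ 2) +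
          (2 * (2 * (m : ℝ) ^ 2) + 2) * π ^ 2 * |Real.cos θ ^ (2 * (2 * m ^ 2) + 2)|) :=
          mul_le_mul_of_nonneg_left h1 hs0
      _ = (2 * (2 * (m : ℝ) ^ 2) + 2) * (2 * (2 * (m : ℝ) ^ 2) + 1) * π ^ 2 *
            ((Real.cos θ ^ 2) ^ (2 * m ^ 2) * Real.sin θ ^ 4) +
          (2 * (2 * (m : ℝ) ^ 2) + 2) * π ^ 2 *
            (|Real.cos θ ^ (2 * (2 * m ^ 2) + 2)| * Real.sin θ ^ 2) := by ring
      _ ≤ 36 * (m : ℝ) ^ 4 * π ^ 2 * (1 / (m : ℝ) ^ 4) +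
          6 * (m : ℝ) ^ 2 * π ^ 2 * (1 / (2 * (m : ℝ) ^ 2)) := by
          gcongr ?_ * _ * ?_ + ?_ * _ * ?_
          exact (mul_le_mul_of_nonneg_right hY hs0).trans k2
      _ = 39 * π ^ 2 := by field_simp; ring
  -- assemble with `(a + b)² ≤ 2a² + 2b²`
  have hsq : Real.sin (π * (z - y - w)) ^ 2 ≤ 2 * Real.sin θ ^ 2 + 2 * (π * (2 / m)) ^ 2 := by
    have h1 : Real.sin (π * (z - y - w)) ^ 2 ≤ (|Real.sin θ| + π * (2 / m)) ^ 2 := by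
      rw [← sq_abs (Real.sin (π * (z - y - w)))]
      exact pow_le_pow_left₀ (abs_nonneg _) hshift 2
    have h2 : (|Real.sin θ| + π * (2 / m)) ^ 2 ≤ 2 * |Real.sin θ| ^ 2 + 2 * (π * (2 / m)) ^ 2 := by
      nlinarith [sq_nonneg (|Real.sin θ| - π * (2 / m))]
    rw [sq_abs] at h2
    exact h1.trans h2
  rw [abs_mul, abs_of_nonneg (sq_nonneg _)]
  calc Real.sin (π * (z - y - w)) ^ 2 * |uK2 (2 * (2 * m ^ 2)) c z|
      ≤ (2 * Real.sin θ ^ 2 + 2 * (π * (2 / m)) ^ 2) * |uK2 (2 * (2 * m ^ 2)) c z| :=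
        mul_le_mul_of_nonneg_right hsq (abs_nonneg _)
    _ = 2 * (Real.sin θ ^ 2 * |uK2 (2 * (2 * m ^ 2)) c z|) +
          2 * (π * (2 / m)) ^ 2 * |uK2 (2 * (2 * m ^ 2)) c z| := by ring
    _ ≤ 2 * (39 * π ^ 2) + 2 * (π * (2 / m)) ^ 2 * (24 * π ^ 2 * m ^ 2) := by gcongr
    _ = 78 * π ^ 2 + 192 * π ^ 4 := by field_simp; ring

end Majorants


/-! ### The left-hand side: `Φ(x,b)² - Φ(y,b)² ≳ w²b²t` and the Bernoulli sandwich -/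

/-- `sin²(π/4 + πt) = 1/2 + sin(2πt)/2` and `sin²(π/4) = 1/2`. [folklore] -/
theorem sin_sq_quarter_add (t : ℝ) :
    Real.sin (π * (1 / 4 + t)) ^ 2 = 1 / 2 + Real.sin (2 * π * t) / 2 := by
  rw [Real.sin_sq_eq_half_sub, show 2 * (π * (1 / 4 + t)) = 2 * π * t + π / 2 by ring,
    Real.cos_add_pi_div_two]
  ring

/-- `sin²(π/4) = 1/2`. [folklore] -/
theorem sin_sq_quarter : Real.sin (π * (1 / 4)) ^ 2 = 1 / 2 := by
  have := sin_sq_quarter_add 0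
  simpa using this

/-- An abstract squeeze: if `|Φx| ≥ ℓ`, `|Φy| ≤ υ`, `ℓ - υ ≥ p ≥ 0`, `ℓ + υ ≥ q ≥ 0`, then
`Φx² - Φy² ≥ pq`. [folklore] -/
theorem sq_sub_sq_ge_of_bounds {Φx Φy ℓ υ p q : ℝ} (hx : ℓ ≤ |Φx|) (hy : |Φy| ≤ υ)
    (hp : p ≤ ℓ - υ) (hp0 : 0 ≤ p) (hq : q ≤ ℓ + υ) (hq0 : 0 ≤ q) :
    p * q ≤ Φx ^ 2 - Φy ^ 2 := by
  have hυ0 : 0 ≤ υ := (abs_nonneg _).trans hy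
  have hℓ0 : 0 ≤ ℓ := by linarith
  have h1 : ℓ ^ 2 ≤ Φx ^ 2 := by
    rw [← sq_abs Φx]; exact pow_le_pow_left₀ hℓ0 hx 2
  have h2 : Φy ^ 2 ≤ υ ^ 2 := by
    rw [← sq_abs Φy]; exact pow_le_pow_left₀ (abs_nonneg _) hy 2
  have h3 : p * q ≤ (ℓ - υ) * (ℓ + υ) := mul_le_mul hp hq hq0 (by linarith)
  nlinarith

/-- **`Φ(1/4 + t, b)² - Φ(1/4, b)² ≥ w²b²t/2`** for `|b| ≤ 1/2`, `0 < t ≤ 1/4`, `w` small and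
`C_L w ≤ t`: the first-order difference `wb(sin²πx - sin²πy) = wb sin(2πt)/2 ≥ 2wbt` of the
expansion (3.11) dominates. [cite: AjankiHuveneers2011, Lemma 3.2 eq. (3.11)] -/
theorem ahPhi_sq_sub_sq_lower :
    ∃ w₀ : ℝ, 0 < w₀ ∧ ∃ CL : ℝ, 0 ≤ CL ∧ ∀ w ∈ Set.Ioc 0 w₀, ∀ t : ℝ, 0 < t → t ≤ 1 / 4 →
      CL * w ≤ t → ∀ b ∈ Set.Icc (-(1 / 2 : ℝ)) (1 / 2),
        w ^ 2 * b ^ 2 * t / 2 ≤ ahPhi w (1 / 4 + t) b ^ 2 - ahPhi w (1 / 4) b ^ 2 := by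
  obtain ⟨w₀, hw₀, C, hC⟩ := ahPhi_expansion (-(1 / 2 : ℝ)) (1 / 2)
  refine ⟨min w₀ 1, by positivity, π / 2 + 2 * |C|, by positivity, ?_⟩
  intro w hw t ht0 ht4 hsmall b hb
  obtain ⟨hw0, hwle⟩ := hw
  have hww₀ : w ≤ w₀ := hwle.trans (min_le_left _ _)
  have hw1 : w ≤ 1 := hwle.trans (min_le_right _ _)
  have hbabs : |b| ≤ 1 / 2 := abs_le.mpr ⟨by linarith [hb.1], hb.2⟩
  -- the sines (we write `x = 1/4 + t`, `y = 1/4` in full: `set` would also abstract `t ≤ 1/4`)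
  obtain ⟨sx2, hsx2⟩ : ∃ sx2 : ℝ, sx2 = Real.sin (π * (1 / 4 + t)) ^ 2 := ⟨_, rfl⟩
  obtain ⟨sy2, hsy2⟩ : ∃ sy2 : ℝ, sy2 = Real.sin (π * (1 / 4 : ℝ)) ^ 2 := ⟨_, rfl⟩
  have hsx : sx2 = 1 / 2 + Real.sin (2 * π * t) / 2 := by rw [hsx2]; exact sin_sq_quarter_add t
  have hsy : sy2 = 1 / 2 := by rw [hsy2]; exact sin_sq_quarter
  have hsin0 : 0 ≤ Real.sin (2 * π * t) :=
    Real.sin_nonneg_of_nonneg_of_le_pi (by positivity) (by nlinarith [Real.pi_pos])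
  have hsin1 : Real.sin (2 * π * t) ≤ 1 := Real.sin_le_one _
  have hjordan : 4 * t ≤ Real.sin (2 * π * t) := by
    have h := Real.mul_le_sin (by positivity : 0 ≤ 2 * π * t) (by nlinarith [Real.pi_pos])
    have e : 2 / π * (2 * π * t) = 4 * t := by field_simp; ring
    linarith [e.symm.le, e.le]
  have hdiff : 2 * t ≤ sx2 - sy2 := by rw [hsx, hsy]; linarith
  have hdiff1 : sx2 - sy2 ≤ 1 := by rw [hsx, hsy]; linarith
  have hsum : 1 ≤ sx2 + sy2 := by rw [hsx, hsy]; linarith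
  have hsx1 : sx2 ≤ 1 := by rw [hsx2]; exact Real.sin_sq_le_one _
  have hsy1 : sy2 ≤ 1 := by rw [hsy]; norm_num
  have hsx0 : 0 ≤ sx2 := by rw [hsx2]; exact sq_nonneg _
  have hsy0 : 0 ≤ sy2 := by rw [hsy2]; exact sq_nonneg _
  -- the expansion
  have ex := hC w ⟨hw0, hww₀⟩ (1 / 4 + t) b hb
  have ey := hC w ⟨hw0, hww₀⟩ (1 / 4) b hb
  rw [← hsx2] at ex
  rw [← hsy2] at ey
  have hCx : |ahPhi w (1 / 4 + t) b -
      sx2 * (w * b + w ^ 2 * b ^ 2 * (π / 2) * Real.sin (2 * π * (1 / 4 + t)))| ≤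
      |C| * w ^ 3 * |b| := by
    refine ex.trans ?_
    calc C * w ^ 3 * |b| * sx2 ≤ |C| * w ^ 3 * |b| * sx2 := by
          gcongr; exact le_abs_self C
      _ ≤ |C| * w ^ 3 * |b| * 1 := by gcongr
      _ = |C| * w ^ 3 * |b| := mul_one _
  have hCy : |ahPhi w (1 / 4) b -
      sy2 * (w * b + w ^ 2 * b ^ 2 * (π / 2) * Real.sin (2 * π * (1 / 4)))| ≤
      |C| * w ^ 3 * |b| := by
    refine ey.trans ?_
    calc C * w ^ 3 * |b| * sy2 ≤ |C| * w ^ 3 * |b| * sy2 := by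
          gcongr; exact le_abs_self C
      _ ≤ |C| * w ^ 3 * |b| * 1 := by gcongr
      _ = |C| * w ^ 3 * |b| := mul_one _
  -- the main terms: `sx2 (w|b| - w²b²π/2) ≤ |main_x|`, `|main_y| ≤ sy2 (w|b| + w²b²π/2)`
  have hmx : sx2 * (w * |b| - w ^ 2 * b ^ 2 * (π / 2)) ≤
      |sx2 * (w * b + w ^ 2 * b ^ 2 * (π / 2) * Real.sin (2 * π * (1 / 4 + t)))| := by
    rw [abs_mul, abs_of_nonneg hsx0]
    refine mul_le_mul_of_nonneg_left ?_ hsx0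
    have h1 : |w ^ 2 * b ^ 2 * (π / 2) * Real.sin (2 * π * (1 / 4 + t))| ≤
        w ^ 2 * b ^ 2 * (π / 2) := by
      rw [abs_mul, abs_of_nonneg (by positivity : (0:ℝ) ≤ w ^ 2 * b ^ 2 * (π / 2))]
      exact mul_le_of_le_one_right (by positivity) (Real.abs_sin_le_one _)
    have h2 : |w * b| = w * |b| := by rw [abs_mul, abs_of_pos hw0]
    have h3 := abs_sub_abs_le_abs_sub (w * b)
      (-(w ^ 2 * b ^ 2 * (π / 2) * Real.sin (2 * π * (1 / 4 + t))))
    rw [sub_neg_eq_add, abs_neg] at h3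
    linarith
  have hmy : |sy2 * (w * b + w ^ 2 * b ^ 2 * (π / 2) * Real.sin (2 * π * (1 / 4)))| ≤
      sy2 * (w * |b| + w ^ 2 * b ^ 2 * (π / 2)) := by
    rw [abs_mul, abs_of_nonneg hsy0]
    refine mul_le_mul_of_nonneg_left ?_ hsy0
    have h1 : |w ^ 2 * b ^ 2 * (π / 2) * Real.sin (2 * π * (1 / 4))| ≤ w ^ 2 * b ^ 2 * (π / 2) := by
      rw [abs_mul, abs_of_nonneg (by positivity : (0:ℝ) ≤ w ^ 2 * b ^ 2 * (π / 2))]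
      exact mul_le_of_le_one_right (by positivity) (Real.abs_sin_le_one _)
    have h2 : |w * b| = w * |b| := by rw [abs_mul, abs_of_pos hw0]
    have h3 := abs_add_le (w * b) (w ^ 2 * b ^ 2 * (π / 2) * Real.sin (2 * π * (1 / 4)))
    linarith
  -- `ℓ ≤ |Φx|`, `|Φy| ≤ υ`
  obtain ⟨ℓ, hℓ⟩ : ∃ ℓ : ℝ, ℓ = sx2 * (w * |b| - w ^ 2 * b ^ 2 * (π / 2)) - |C| * w ^ 3 * |b| :=
    ⟨_, rfl⟩
  obtain ⟨υ, hυ⟩ : ∃ υ : ℝ, υ = sy2 * (w * |b| + w ^ 2 * b ^ 2 * (π / 2)) + |C| * w ^ 3 * |b| :=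
    ⟨_, rfl⟩
  have hℓx : ℓ ≤ |ahPhi w (1 / 4 + t) b| := by
    have h3 := abs_sub_abs_le_abs_sub
      (sx2 * (w * b + w ^ 2 * b ^ 2 * (π / 2) * Real.sin (2 * π * (1 / 4 + t))))
      (ahPhi w (1 / 4 + t) b)
    rw [abs_sub_comm] at h3
    rw [hℓ]; linarith
  have hυy : |ahPhi w (1 / 4) b| ≤ υ := by
    have h3 := abs_sub_abs_le_abs_sub (ahPhi w (1 / 4) b)
      (sy2 * (w * b + w ^ 2 * b ^ 2 * (π / 2) * Real.sin (2 * π * (1 / 4))))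
    rw [hυ]; linarith
  -- `ℓ - υ ≥ w|b|t`, `ℓ + υ ≥ w|b|/2`
  have hb2 : b ^ 2 = |b| ^ 2 := (sq_abs b).symm
  have hab0 : 0 ≤ |b| := abs_nonneg b
  have hwb : w * |b| ≤ w * (1 / 2) := by gcongr
  have hp : w * |b| * t ≤ ℓ - υ := by
    -- ℓ - υ = w|b|(sx2 - sy2) - (sx2 + sy2) w² b² π/2 - 2|C| w³ |b|
    have e : ℓ - υ = w * |b| * ((sx2 - sy2) - (sx2 + sy2) * (w * |b|) * (π / 2) -
        2 * |C| * w ^ 2) := by rw [hℓ, hυ, hb2]; ring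
    rw [e]
    refine mul_le_mul_of_nonneg_left ?_ (by positivity)
    -- (sx2+sy2) w|b| π/2 ≤ 2 (w/2) π/2 = w π/2 and 2|C|w² so need 2t - wπ/2 - 2|C|w² ≥ t
    have h1 : (sx2 + sy2) * (w * |b|) * (π / 2) ≤ 2 * (w * (1 / 2)) * (π / 2) := by
      gcongr; linarith
    have h2 : 2 * |C| * w ^ 2 ≤ 2 * |C| * w := by
      have : w ^ 2 ≤ w := by nlinarith
      gcongr
    have h3 : (π / 2 + 2 * |C|) * w ≤ t := hsmall
    linarith
  have hq : w * |b| * (1 / 2) ≤ ℓ + υ := by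
    have e : ℓ + υ = w * |b| * ((sx2 + sy2) - (sx2 - sy2) * (w * |b|) * (π / 2)) := by
      rw [hℓ, hυ, hb2]; ring
    rw [e]
    refine mul_le_mul_of_nonneg_left ?_ (by positivity)
    have h1 : (sx2 - sy2) * (w * |b|) * (π / 2) ≤ 1 * (w * (1 / 2)) * (π / 2) := by
      gcongr
    have h3 : (π / 2 + 2 * |C|) * w ≤ 1 / 4 := hsmall.trans ht4
    have h4 : 0 ≤ |C| * w := by positivity
    linarith
  have key := sq_sub_sq_ge_of_bounds hℓx hυy hp (by positivity) hq (by positivity)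
  calc w ^ 2 * b ^ 2 * t / 2 = w * |b| * t * (w * |b| * (1 / 2)) := by rw [hb2]; ring
    _ ≤ ahPhi w (1 / 4 + t) b ^ 2 - ahPhi w (1 / 4) b ^ 2 := key

/-- **The Bernoulli sandwich.** With `σₐ = sin²(πΦx)`, `σ_b = sin²(πΦy)`:
`(1-σ_b)^{N'} - (1-σₐ)^{N'} ≥ N'(σₐ - σ_b) - N'²σₐ² ≥ N'(π²w²b²t/2 - 2π⁴(Gw)⁴) - N'²π⁴(Gw)⁴`.
[folklore] -/
theorem cos_pow_sub_cos_pow_lower (N' : ℕ) {Φx Φy w b t G : ℝ}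
    (hsq : w ^ 2 * b ^ 2 * t / 2 ≤ Φx ^ 2 - Φy ^ 2) (hGx : |Φx| ≤ G * w)
    (hπG : π * (G * w) ≤ 1) :
    N' * (π ^ 2 * (w ^ 2 * b ^ 2 * t / 2) - 2 * π ^ 4 * (G * w) ^ 4) -
        (N' : ℝ) ^ 2 * (π ^ 4 * (G * w) ^ 4) ≤
      (Real.cos (π * Φy) ^ 2) ^ N' - (Real.cos (π * Φx) ^ 2) ^ N' := by
  set σa := Real.sin (π * Φx) ^ 2 with hσa
  set σb := Real.sin (π * Φy) ^ 2 with hσb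
  have hσa0 : 0 ≤ σa := sq_nonneg _
  have hσa1 : σa ≤ 1 := Real.sin_sq_le_one _
  have hσb1 : σb ≤ 1 := Real.sin_sq_le_one _
  have hca : Real.cos (π * Φx) ^ 2 = 1 - σa := Real.cos_sq' _
  have hcb : Real.cos (π * Φy) ^ 2 = 1 - σb := Real.cos_sq' _
  rw [hca, hcb]
  have hlow : 1 - N' * σb ≤ (1 - σb) ^ N' := one_sub_mul_le_one_sub_pow (by linarith) N'
  have hup : (1 - σa) ^ N' ≤ 1 - N' * σa + (N' : ℝ) ^ 2 * σa ^ 2 := one_sub_pow_le hσa0 hσa1 N'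
  -- `σa ≥ (πΦx)² - 2(πΦx)⁴`, `σb ≤ (πΦy)²`, `σa ≤ (πΦx)²`
  have hπΦx : |π * Φx| ≤ 1 := by
    rw [abs_mul, abs_of_pos Real.pi_pos]
    exact (mul_le_mul_of_nonneg_left hGx Real.pi_pos.le).trans hπG
  have hσa_lo : (π * Φx) ^ 2 - 2 * (π * Φx) ^ 4 ≤ σa := sq_sub_le_sin_sq hπΦx
  have hσb_hi : σb ≤ (π * Φy) ^ 2 := Real.sin_sq_le_sq
  have hσa_hi : σa ≤ (π * Φx) ^ 2 := Real.sin_sq_le_sq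
  have hΦx4 : Φx ^ 4 ≤ (G * w) ^ 4 := by
    have e : Φx ^ 4 = |Φx| ^ 4 := by
      rw [show (4 : ℕ) = 2 * 2 from rfl, pow_mul, pow_mul, sq_abs]
    rw [e]
    exact pow_le_pow_left₀ (abs_nonneg _) hGx 4
  have hσa_sq : σa ^ 2 ≤ π ^ 4 * (G * w) ^ 4 := by
    calc σa ^ 2 ≤ ((π * Φx) ^ 2) ^ 2 := pow_le_pow_left₀ hσa0 hσa_hi 2
      _ = π ^ 4 * Φx ^ 4 := by ring
      _ ≤ π ^ 4 * (G * w) ^ 4 := by gcongr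
  have hN0 : (0 : ℝ) ≤ N' := Nat.cast_nonneg _
  have hdiff : π ^ 2 * (w ^ 2 * b ^ 2 * t / 2) - 2 * π ^ 4 * (G * w) ^ 4 ≤ σa - σb := by
    have e1 : (π * Φx) ^ 2 = π ^ 2 * Φx ^ 2 := by ring
    have e2 : (π * Φx) ^ 4 = π ^ 4 * Φx ^ 4 := by ring
    have e3 : (π * Φy) ^ 2 = π ^ 2 * Φy ^ 2 := by ring
    rw [e1, e2] at hσa_lo
    rw [e3] at hσb_hi
    have h2 : π ^ 2 * (w ^ 2 * b ^ 2 * t / 2) ≤ π ^ 2 * (Φx ^ 2 - Φy ^ 2) :=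
      mul_le_mul_of_nonneg_left hsq (by positivity)
    have h5 : 2 * π ^ 4 * Φx ^ 4 ≤ 2 * π ^ 4 * (G * w) ^ 4 := by gcongr
    have h6 : π ^ 2 * (Φx ^ 2 - Φy ^ 2) = π ^ 2 * Φx ^ 2 - π ^ 2 * Φy ^ 2 := by ring
    linarith
  have h3 : (N' : ℝ) * (π ^ 2 * (w ^ 2 * b ^ 2 * t / 2) - 2 * π ^ 4 * (G * w) ^ 4) ≤
      N' * (σa - σb) := mul_le_mul_of_nonneg_left hdiff hN0
  have h4 : (N' : ℝ) ^ 2 * σa ^ 2 ≤ (N' : ℝ) ^ 2 * (π ^ 4 * (G * w) ^ 4) :=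
    mul_le_mul_of_nonneg_left hσa_sq (sq_nonneg _)
  linarith


/-! ### The final arithmetic -/

/-- `π² ≤ 16`, `π⁴ ≤ 256`. [folklore] -/
theorem pi_pow_bounds : π ^ 2 ≤ 16 ∧ π ^ 4 ≤ 256 := by
  have h2 : π ^ 2 ≤ 4 ^ 2 := pow_le_pow_left₀ Real.pi_pos.le Real.pi_le_four 2
  have h4 : π ^ 4 ≤ 4 ^ 4 := pow_le_pow_left₀ Real.pi_pos.le Real.pi_le_four 4
  constructor <;> linarith

/-- The four majorants sum to at most `51000` (for `w ≤ 1/M²`, `M ≥ 1`). [folklore] -/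
theorem majorants_sum_le {M w : ℝ} (hM : 1 ≤ M) (hwM : w ≤ 1 / M ^ 2) :
    (3 * π + 6 * π ^ 2) + w * (3 * π * M) + (78 * π ^ 2 + 192 * π ^ 4) +
      w * (24 * π ^ 2 * M ^ 2) ≤ 51000 := by
  obtain ⟨hπ2, hπ4⟩ := pi_pow_bounds
  have hπ := Real.pi_le_four
  have hM0 : 0 < M := by linarith
  have h1 : w * (3 * π * M) ≤ 3 * π := by
    calc w * (3 * π * M) ≤ 1 / M ^ 2 * (3 * π * M) := by gcongr
      _ = 3 * π * (1 / M) := by field_simp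
      _ ≤ 3 * π * 1 := by
          gcongr
          rw [div_le_one hM0]; exact hM
      _ = 3 * π := mul_one _
  have h2 : w * (24 * π ^ 2 * M ^ 2) ≤ 24 * π ^ 2 := by
    calc w * (24 * π ^ 2 * M ^ 2) ≤ 1 / M ^ 2 * (24 * π ^ 2 * M ^ 2) := by gcongr
      _ = 24 * π ^ 2 := by field_simp
  linarith

/-- The contradiction in numbers: `Nπ²t/24 ≥ Mπ²/12 > 51000K + 16π⁴G⁴ ≥ K·(majorants) + (2N+N²)π⁴G⁴w²`
once `M ≥ 2(51000K + 16π⁴G⁴)`, `w ≤ 1/M²`, `t = 1/M`, `N = 2M² + 1`. [folklore] -/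
theorem final_contra {M K G w t N : ℝ} (hM : 4 ≤ M) (hK : 0 < K)
    (hbig : 2 * (51000 * K + 16 * π ^ 4 * G ^ 4) ≤ M) (hw0 : 0 < w) (hwM : w ≤ 1 / M ^ 2)
    (ht : t = 1 / M) (hN : N = 2 * M ^ 2 + 1)
    (hle : N * π ^ 2 * w ^ 2 * t / 2 * (1 / 12) -
        (2 * N * π ^ 4 * (G * w) ^ 4 + N ^ 2 * π ^ 4 * (G * w) ^ 4) ≤
      K * w ^ 2 * ((3 * π + 6 * π ^ 2) + w * (3 * π * M) + (78 * π ^ 2 + 192 * π ^ 4) +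
        w * (24 * π ^ 2 * M ^ 2))) : False := by
  have hM1 : 1 ≤ M := by linarith
  have hM0 : 0 < M := by linarith
  have hsum := majorants_sum_le hM1 hwM
  have hw2 : 0 < w ^ 2 := by positivity
  -- divide by `w²`
  have hle' : N * π ^ 2 * t / 24 - (2 * N + N ^ 2) * π ^ 4 * G ^ 4 * w ^ 2 ≤ K * 51000 := by
    have e1 : N * π ^ 2 * w ^ 2 * t / 2 * (1 / 12) -
        (2 * N * π ^ 4 * (G * w) ^ 4 + N ^ 2 * π ^ 4 * (G * w) ^ 4) =
        w ^ 2 * (N * π ^ 2 * t / 24 - (2 * N + N ^ 2) * π ^ 4 * G ^ 4 * w ^ 2) := by ring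
    have e2 : K * w ^ 2 * ((3 * π + 6 * π ^ 2) + w * (3 * π * M) + (78 * π ^ 2 + 192 * π ^ 4) +
        w * (24 * π ^ 2 * M ^ 2)) = w ^ 2 * (K * ((3 * π + 6 * π ^ 2) + w * (3 * π * M) +
          (78 * π ^ 2 + 192 * π ^ 4) + w * (24 * π ^ 2 * M ^ 2))) := by ring
    rw [e1, e2] at hle
    have h3 := le_of_mul_le_mul_left hle hw2
    have h4 : K * ((3 * π + 6 * π ^ 2) + w * (3 * π * M) + (78 * π ^ 2 + 192 * π ^ 4) +
        w * (24 * π ^ 2 * M ^ 2)) ≤ K * 51000 := mul_le_mul_of_nonneg_left hsum hK.le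
    linarith
  -- the error term: `(2N + N²) w² ≤ 16 M⁴ w² ≤ 16`
  have hNN : (2 * N + N ^ 2) * w ^ 2 ≤ 16 := by
    have h1 : 2 * N + N ^ 2 ≤ 16 * M ^ 4 := by rw [hN]; nlinarith [pow_le_pow_left₀ zero_le_one hM1 2]
    have h2 : M ^ 2 * w ≤ 1 := by
      calc M ^ 2 * w ≤ M ^ 2 * (1 / M ^ 2) := by gcongr
        _ = 1 := by field_simp
    have h3 : M ^ 4 * w ^ 2 ≤ 1 := by
      have : M ^ 4 * w ^ 2 = (M ^ 2 * w) ^ 2 := by ring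
      rw [this]; exact pow_le_one₀ (by positivity) h2
    calc (2 * N + N ^ 2) * w ^ 2 ≤ 16 * M ^ 4 * w ^ 2 := by gcongr
      _ = 16 * (M ^ 4 * w ^ 2) := by ring
      _ ≤ 16 * 1 := by gcongr
      _ = 16 := by norm_num
  have herr : (2 * N + N ^ 2) * π ^ 4 * G ^ 4 * w ^ 2 ≤ 16 * π ^ 4 * G ^ 4 := by
    calc (2 * N + N ^ 2) * π ^ 4 * G ^ 4 * w ^ 2 = ((2 * N + N ^ 2) * w ^ 2) * (π ^ 4 * G ^ 4) := by
          ring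
      _ ≤ 16 * (π ^ 4 * G ^ 4) := by gcongr
      _ = 16 * π ^ 4 * G ^ 4 := by ring
  -- the main term: `Nπ²t/24 ≥ Mπ²/12`
  have hmainT : M * π ^ 2 / 12 ≤ N * π ^ 2 * t / 24 := by
    rw [hN, ht]
    have e : (2 * M ^ 2 + 1) * π ^ 2 * (1 / M) / 24 = M * π ^ 2 / 12 + π ^ 2 / (24 * M) := by
      field_simp; ring
    rw [e]
    have : 0 ≤ π ^ 2 / (24 * M) := by positivity
    linarith
  -- `Mπ²/12 > 51000K + 16π⁴G⁴`
  have hπ9 : 9 ≤ π ^ 2 := by nlinarith [Real.pi_gt_three]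
  have hX0 : 0 ≤ 51000 * K + 16 * π ^ 4 * G ^ 4 := by positivity
  have hbig' : (51000 * K + 16 * π ^ 4 * G ^ 4) * 18 ≤ M * π ^ 2 := by
    calc (51000 * K + 16 * π ^ 4 * G ^ 4) * 18 = 2 * (51000 * K + 16 * π ^ 4 * G ^ 4) * 9 := by ring
      _ ≤ M * π ^ 2 := mul_le_mul hbig hπ9 (by norm_num) hM0.le
  nlinarith

/-! ### The refutation -/

-- names the `@[deprecated]` record `AjankiHuveneers2011_RyEstimate` of `DisorderedHarmonicChainPotential.lean`
-- on purpose: this IS its refutation (verdict clean-up 2026-08-16); REMOVE-WHEN the record is deleted there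
set_option linter.deprecated false in
open Literature.Barriers.AtomisticToContinuum in
/-- **AH2011 Lemma 5.3, eq. (5.12), is false as printed**: the named fact
`AjankiHuveneers2011_RyEstimate` (the faithful transcription of (5.12)) is refuted by `h = 0`,
the uniform reduced law on `[-1/2, 1/2]`, `y = 1/4`, `x = 1/4 + 1/m`, `u = cos^{4m²+2}(π(· - x - ϑ))`
and `w ≤ m⁻²` small, for `m` large in terms of the purported constant `K`. (The corrected bound,
with `‖sin π(·-y-w) u''‖_∞` in place of `‖sin² π(·-y-w) u''‖_∞`, is
`AjankiHuveneers2011_RyEstimateCorrected`, proved in `DisorderedHarmonicChainRyEstimate.lean`.)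
[cite: AjankiHuveneers2011, Lemma 5.3 eq. (5.12)] -/
theorem ryEstimate_false : ¬ AjankiHuveneers2011_RyEstimate := by
  intro hR
  obtain ⟨w₀, hw₀, K, hK, hmain⟩ :=
    hR τu (-(1 / 2)) (1 / 2) reducedLawHyp_τu (fun _ => 0) (fun _ => rfl) contDiff_const
  -- constants attached to `Φ`
  obtain ⟨wG, hwG, G, hG0, hG⟩ := ahPhi_abs_le (-(1 / 2 : ℝ)) (1 / 2)
  obtain ⟨wL, hwL, CL, hCL0, hL⟩ := ahPhi_sq_sub_sq_lower
  -- the size parameter `m`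
  obtain ⟨m, hm⟩ := exists_nat_ge (max 4 (2 * (51000 * K + 16 * π ^ 4 * G ^ 4)))
  have hM4 : (4 : ℝ) ≤ m := (le_max_left _ _).trans hm
  have hbig : 2 * (51000 * K + 16 * π ^ 4 * G ^ 4) ≤ (m : ℝ) := (le_max_right _ _).trans hm
  have hm1 : 1 ≤ m := by exact_mod_cast (show (1 : ℝ) ≤ m by linarith)
  have hM0 : (0 : ℝ) < m := by linarith
  -- `t`, `w`
  obtain ⟨t, ht⟩ : ∃ t : ℝ, t = 1 / (m : ℝ) := ⟨_, rfl⟩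
  have ht0 : 0 < t := by rw [ht]; positivity
  have ht4 : t ≤ 1 / 4 := by rw [ht]; exact one_div_le_one_div_of_le (by norm_num) hM4
  obtain ⟨w, hw⟩ : ∃ w : ℝ, w = min (min w₀ (min wG wL))
      (min (1 / (m : ℝ) ^ 2) (min (t / (CL + 1)) (1 / (π * G + 1)))) := ⟨_, rfl⟩
  have hw0 : 0 < w := by rw [hw]; positivity
  have hww₀ : w ≤ w₀ := by rw [hw]; exact (min_le_left _ _).trans (min_le_left _ _)
  have hwwG : w ≤ wG := by
    rw [hw]; exact (min_le_left _ _).trans ((min_le_right _ _).trans (min_le_left _ _))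
  have hwwL : w ≤ wL := by
    rw [hw]; exact (min_le_left _ _).trans ((min_le_right _ _).trans (min_le_right _ _))
  have hwM : w ≤ 1 / (m : ℝ) ^ 2 := by rw [hw]; exact (min_le_right _ _).trans (min_le_left _ _)
  have hwCL : w ≤ t / (CL + 1) := by
    rw [hw]; exact (min_le_right _ _).trans ((min_le_right _ _).trans (min_le_left _ _))
  have hwπG : w ≤ 1 / (π * G + 1) := by
    rw [hw]; exact (min_le_right _ _).trans ((min_le_right _ _).trans (min_le_right _ _))
  have hwt : w ≤ t := by
    refine hwM.trans ?_
    rw [ht]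
    calc 1 / (m : ℝ) ^ 2 = 1 / m * (1 / m) := by field_simp
      _ ≤ 1 / m * 1 := by
          gcongr
          rw [div_le_one hM0]; linarith
      _ = 1 / m := mul_one _
  have hw5 : w ≤ 1 / 5 := by
    refine hwM.trans ?_
    calc 1 / (m : ℝ) ^ 2 ≤ 1 / 4 ^ 2 := by
          gcongr
      _ ≤ 1 / 5 := by norm_num
  have hCLw : CL * w ≤ t := by
    calc CL * w ≤ CL * (t / (CL + 1)) := by gcongr
      _ ≤ (CL + 1) * (t / (CL + 1)) := by gcongr; linarith
      _ = t := by field_simp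
  have hπGw : π * (G * w) ≤ 1 := by
    calc π * (G * w) = (π * G) * w := by ring
      _ ≤ (π * G) * (1 / (π * G + 1)) := by gcongr
      _ ≤ (π * G + 1) * (1 / (π * G + 1)) := by gcongr; linarith
      _ = 1 := by field_simp
  -- `ϑ = w + 𝒪(w³)`
  have hϑlo : w ≤ ahTheta w := ahTheta_ge hw0.le (by nlinarith [Real.pi_le_four])
  have hϑhi : ahTheta w ≤ w + w ^ 3 := ahTheta_le hw0.le hw5
  -- the centre `c = x + ϑ`, `x = 1/4 + t`, `y = 1/4`
  obtain ⟨c, hc⟩ : ∃ c : ℝ, c = 1 / 4 + t + ahTheta w := ⟨_, rfl⟩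
  have hδ : |c - 1 / 4 - w| ≤ 2 / (m : ℝ) := by
    have e : c - 1 / 4 - w = t + (ahTheta w - w) := by rw [hc]; ring
    rw [e, abs_of_nonneg (by linarith)]
    have hw3 : w ^ 3 ≤ w := pow_le_of_le_one hw0.le (by linarith) three_ne_zero
    calc t + (ahTheta w - w) ≤ t + t := by linarith
      _ = 2 / (m : ℝ) := by rw [ht]; ring
  -- the test function
  obtain ⟨u, hu⟩ : ∃ u : ℝ → ℝ, u = uK (2 * (2 * m ^ 2)) c := ⟨_, rfl⟩
  have hu_per : Function.Periodic u 1 := by rw [hu]; exact periodic_uK _ c ⟨2 * m ^ 2, by ring⟩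
  have hu_cd : ContDiff ℝ 2 u := by rw [hu]; exact contDiff_uK _ c
  have h1 : ∀ z, |Real.sin (π * (z - 1 / 4 - w)) * deriv u z| ≤ 3 * π + 6 * π ^ 2 := by
    intro z; rw [hu, deriv_uK]; exact abs_sin_mul_uK1_le hm1 c hδ z
  have h1' : ∀ z, |deriv u z| ≤ 3 * π * m := by
    intro z; rw [hu, deriv_uK]; exact abs_uK1_le hm1 c z
  have h2 : ∀ z, |Real.sin (π * (z - 1 / 4 - w)) ^ 2 * iteratedDeriv 2 u z| ≤
      78 * π ^ 2 + 192 * π ^ 4 := by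
    intro z; rw [hu, iteratedDeriv_two_uK]; exact abs_sin_sq_mul_uK2_le hm1 c hδ z
  have h2' : ∀ z, |iteratedDeriv 2 u z| ≤ 24 * π ^ 2 * m ^ 2 := by
    intro z; rw [hu, iteratedDeriv_two_uK]; exact abs_uK2_le hm1 c z
  -- the purported bound
  have hUB := hmain w ⟨hw0, hww₀⟩ u hu_per hu_cd (1 / 4) _ _ _ _ h1 h1' h2 h2' (1 / 4 + t)
  -- the two integrands
  obtain ⟨N', hN'⟩ : ∃ N' : ℕ, N' = 2 * m ^ 2 + 1 := ⟨_, rfl⟩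
  have hkN : 2 * (2 * m ^ 2) + 2 = 2 * N' := by rw [hN']; ring
  obtain ⟨Cx, hCx⟩ : ∃ Cx : ℝ → ℝ, Cx = fun b => (Real.cos (π * ahPhi w (1 / 4 + t) b) ^ 2) ^ N' :=
    ⟨_, rfl⟩
  obtain ⟨Cy, hCy⟩ : ∃ Cy : ℝ → ℝ, Cy = fun b => (Real.cos (π * ahPhi w (1 / 4) b) ^ 2) ^ N' :=
    ⟨_, rfl⟩
  have hux : ∀ b, u (ahStep w b (1 / 4 + t)) = Cx b := by
    intro b
    rw [hu, hCx]
    unfold uK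
    rw [show ahStep w b (1 / 4 + t) - c = ahPhi w (1 / 4 + t) b by rw [hc]; unfold ahStep; ring,
      hkN, pow_mul]
  have huy : ∀ b, u (ahG w b (1 / 4 + t) (1 / 4)) = Cy b := by
    intro b
    rw [hu, hCy]
    unfold uK
    rw [show ahG w b (1 / 4 + t) (1 / 4) - c = ahPhi w (1 / 4) b by rw [hc]; unfold ahG; ring,
      hkN, pow_mul]
  have hT : ahT τu w (fun _ => 0) u (1 / 4 + t) = ∫ b, Cx b * τu b := by
    unfold ahT
    congr 1
    funext b
    rw [hux b]
    ring
  have hTy : ahTy τu w (fun _ => 0) (1 / 4) u (1 / 4 + t) = ∫ b, Cy b * τu b := by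
    unfold ahTy
    congr 1
    funext b
    rw [huy b]
    ring
  have hRy : ahRy τu w (fun _ => 0) (1 / 4) u (1 / 4 + t) =
      (∫ b, Cx b * τu b) - ∫ b, Cy b * τu b := by
    rw [ahRy_apply, hT, hTy]
  -- integrability
  have hτ := reducedLawHyp_τu
  have iCx : Integrable fun b => Cx b * τu b := by
    refine hτ.integrable_mul (C := 1) ?_ (fun b _ => ?_)
    · refine Measurable.aestronglyMeasurable ?_
      rw [hCx]
      exact ((Real.continuous_cos.measurable.comp
        ((measurable_ahPhi_right w (1 / 4 + t)).const_mul π)).pow_const 2).pow_const N'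
    · rw [hCx]
      simp only
      rw [abs_of_nonneg (by positivity)]
      exact pow_le_one₀ (sq_nonneg _) (Real.cos_sq_le_one _)
  have iCy : Integrable fun b => Cy b * τu b := by
    refine hτ.integrable_mul (C := 1) ?_ (fun b _ => ?_)
    · refine Measurable.aestronglyMeasurable ?_
      rw [hCy]
      exact ((Real.continuous_cos.measurable.comp
        ((measurable_ahPhi_right w (1 / 4)).const_mul π)).pow_const 2).pow_const N'
    · rw [hCy]
      simp only
      rw [abs_of_nonneg (by positivity)]
      exact pow_le_one₀ (sq_nonneg _) (Real.cos_sq_le_one _)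
  have ib2 : Integrable fun b : ℝ => b ^ 2 * τu b := by
    refine hτ.integrable_mul (f := fun b : ℝ => b ^ 2) (C := (1 / 2) ^ 2)
      (continuous_pow 2).measurable.aestronglyMeasurable (fun b hb => ?_)
    rw [abs_of_nonneg (sq_nonneg b)]
    nlinarith [hb.1, hb.2]
  -- the lower bound integrand `q = A b² τ - E τ`
  obtain ⟨A, hA⟩ : ∃ A : ℝ, A = (N' : ℝ) * π ^ 2 * w ^ 2 * t / 2 := ⟨_, rfl⟩
  obtain ⟨E, hE⟩ : ∃ E : ℝ,
      E = 2 * (N' : ℝ) * π ^ 4 * (G * w) ^ 4 + (N' : ℝ) ^ 2 * π ^ 4 * (G * w) ^ 4 := ⟨_, rfl⟩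
  have iq : Integrable fun b => A * (b ^ 2 * τu b) - E * τu b :=
    (ib2.const_mul A).sub (hτ.integrable.const_mul E)
  have hq_int : ∫ b, (A * (b ^ 2 * τu b) - E * τu b) = A * (1 / 12) - E := by
    rw [integral_sub (ib2.const_mul A) (hτ.integrable.const_mul E), integral_const_mul,
      integral_const_mul, integral_sq_mul_τu, integral_τu, mul_one]
  -- pointwise: `q ≤ (Cy - Cx) τ`
  have hpt : ∀ b, A * (b ^ 2 * τu b) - E * τu b ≤ Cy b * τu b - Cx b * τu b := by
    intro b
    by_cases hb : b ∈ Set.Icc (-(1 / 2 : ℝ)) (1 / 2)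
    · have hτb : τu b = 1 := τu_of_mem hb
      have hsq := hL w ⟨hw0, hwwL⟩ t ht0 ht4 hCLw b hb
      have hGx : |ahPhi w (1 / 4 + t) b| ≤ G * w := by
        refine (hG w ⟨hw0, hwwG⟩ (1 / 4 + t) b hb).trans ?_
        calc G * w * Real.sin (π * (1 / 4 + t)) ^ 2 ≤ G * w * 1 := by
              gcongr; exact Real.sin_sq_le_one _
          _ = G * w := mul_one _
      have key := cos_pow_sub_cos_pow_lower N' hsq hGx hπGw
      calc A * (b ^ 2 * τu b) - E * τu b
          = (N' : ℝ) * (π ^ 2 * (w ^ 2 * b ^ 2 * t / 2) - 2 * π ^ 4 * (G * w) ^ 4) -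
              (N' : ℝ) ^ 2 * (π ^ 4 * (G * w) ^ 4) := by rw [hA, hE, hτb]; ring
        _ ≤ (Real.cos (π * ahPhi w (1 / 4) b) ^ 2) ^ N' -
              (Real.cos (π * ahPhi w (1 / 4 + t) b) ^ 2) ^ N' := key
        _ = Cy b * τu b - Cx b * τu b := by rw [hCy, hCx, hτb]; ring
    · have hτb : τu b = 0 := τu_of_not_mem hb
      rw [hτb]
      simp
  have hLB : A * (1 / 12) - E ≤ (∫ b, Cy b * τu b) - ∫ b, Cx b * τu b := by
    rw [← hq_int, ← integral_sub iCy iCx]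
    exact integral_mono iq (iCy.sub iCx) hpt
  -- combine with the purported upper bound
  have hcomb : A * (1 / 12) - E ≤
      K * w ^ 2 * ((3 * π + 6 * π ^ 2) + w * (3 * π * m) + (78 * π ^ 2 + 192 * π ^ 4) +
        w * (24 * π ^ 2 * m ^ 2)) := by
    have h3 : (∫ b, Cy b * τu b) - ∫ b, Cx b * τu b ≤
        |ahRy τu w (fun _ => 0) (1 / 4) u (1 / 4 + t)| := by
      rw [hRy, abs_sub_comm]; exact le_abs_self _
    exact hLB.trans (h3.trans hUB)
  have hN'cast : ((N' : ℕ) : ℝ) = 2 * (m : ℝ) ^ 2 + 1 := by rw [hN']; push_cast; ring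
  rw [hA, hE] at hcomb
  exact final_contra hM4 hK hbig hw0 hwM ht hN'cast hcomb

end RyCounterexample

end Literature.Barriers.AtomisticToContinuum.HeatConduction

namespace Literature.Barriers.AtomisticToContinuum

-- names the `@[deprecated]` record `AjankiHuveneers2011_RyEstimate` of `DisorderedHarmonicChainPotential.lean`
-- on purpose: this IS its refutation (verdict clean-up 2026-08-16); REMOVE-WHEN the record is deleted there
set_option linter.deprecated false in
/-- **The named fact `AjankiHuveneers2011_RyEstimate` (AH2011 Lemma 5.3, eq. (5.12), as printed)
is FALSE.** See the module docstring for the counterexample and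
`DisorderedHarmonicChainRyEstimate.lean` for the corrected, proved statement.
[cite: AjankiHuveneers2011, Lemma 5.3 eq. (5.12)] -/
theorem AjankiHuveneers2011_RyEstimate_false : ¬ AjankiHuveneers2011_RyEstimate :=
  HeatConduction.RyCounterexample.ryEstimate_false

end Literature.Barriers.AtomisticToContinuum

end
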